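import Summits.QuantumFields.BalabanUV.T4Continuum.Spine.NE2KingTransplant
import Summits.QuantumFields.BalabanUV.T4Continuum.Support.BalabanAveragedTowerUnit

/-!
# T⁴ programme, spine node NE2 (U1a) — THE KING TRANSPLANT, bridge O3:
# the row owner's operator-norm tower law ⟹ the entrywise block-rate leaf (L05) of `Spine/NE2KingTransplant`

Cell `pub-balaban`, unit `b2b-balaban-t4-ne2-p3` (ROUND-2 technique-distinct prover #3 on BINDER row NE2, literature
transplant), companion of `Spine/NE2KingTransplant` (p206677) and of the skeleton `t4/skeletons/NE2-t4-ne2-p3.md` (its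
open item O3 = leaf L05br).  The skeleton's leaf L05 — the one-step SUP rate of the King-averaged blocks
`W_k = Q_kG_k(U_k)Q_k*` read ENTRYWISE on the unit lattice, the currency `King1986.lemma45_of_supRate` consumes — is
produced here from the row owner's (lineage t4-ne2-p1) OPERATOR-NORM tower
(`Spine/CovariantAveragingTower`: `avgTow`, `OneStepAveragedLaw`, `opNorm_avgTow_succ_sub_le`) through the landed
entry bound `Support/BalabanAveragedTowerUnit.norm_entry_le_opNorm` (`‖A i j‖ ≤ ‖A‖`, ℓ²-operator norm).  So the two
routes compose BY NAME: `OneStepAveragedLaw A r X (C·ρ^k)` ⟹ `EffectiveOperatorSupRate`-shaped laws for the real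
parts of the unit-lattice images (`reBlock_supRate`, `imBlock_supRate`), hence — by `effectiveOperatorSupRate_of_block`
(King's (2.14) shape) — the rate leaf (H3) of the covariance layer.  Everything is [folklore] bookkeeping
(`|Re u − Re v| ≤ ‖u − v‖ ≤ ‖M − M′‖`); nothing printed is asserted; no carrier of Bałaban's operators is constructed;
at `U ≠ 1` the hypothesis `OneStepAveragedLaw` is the row owner's typed wall (G-an2-4 / `PerturbationLaws`), asserted
by nobody.  NOT summit progress; spine 0/9.  HONEST DEPENDENCY: continuum YM on T⁴ ⇐ BetaPertH ∧ nine spine estimates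
(0/9 proved); BetaPertH ⇐ (D1) ∧ (D4) ∧ CAP+tail; G-an2-4 gates asym, D1 and NE2/3/4.
-/

noncomputable section

open scoped Matrix Matrix.Norms.L2Operator
open Summit.QuantumFields.BalabanUV.T4Continuum.CovariantAveragingTower (avgTow OneStepAveragedLaw
  opNorm_avgTow_succ_sub_le)
open Summit.QuantumFields.BalabanUV.T4Continuum.BalabanAveragedTowerUnit (norm_entry_le_opNorm)
open Summit.QuantumFields.BalabanUV.T4Continuum.NE2KingTransplant (EffectiveOperatorSupRate effOp
  effectiveOperatorSupRate_of_block)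

namespace Summit.QuantumFields.BalabanUV.T4Continuum.NE2KingTransplantBridge

variable {ι : ℕ → Type*} [∀ k, Fintype (ι k)] [∀ k, DecidableEq (ι k)]

/-- the REAL PARTS of the unit-lattice images `avgTow A r X k` (for the real symmetric operators of the linear theory the
imaginary parts vanish; in general both parts are read, `imBlock`). [folklore] -/
def reBlock (A : (k : ℕ) → Matrix (ι k) (ι (k + 1)) ℂ) (r : ℝ) (X : (k : ℕ) → Matrix (ι k) (ι k) ℂ) (k : ℕ) :
    Matrix (ι 0) (ι 0) ℝ :=
  (avgTow A r X k).map Complex.re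

/-- the IMAGINARY PARTS of the unit-lattice images. [folklore] -/
def imBlock (A : (k : ℕ) → Matrix (ι k) (ι (k + 1)) ℂ) (r : ℝ) (X : (k : ℕ) → Matrix (ι k) (ι k) ℂ) (k : ℕ) :
    Matrix (ι 0) (ι 0) ℝ :=
  (avgTow A r X k).map Complex.im

/-- **operator-norm one-step bound ⟹ entrywise one-step bound (real parts).** [folklore] -/
theorem abs_reBlock_succ_sub_le (A : (k : ℕ) → Matrix (ι k) (ι (k + 1)) ℂ) (r : ℝ)
    (X : (k : ℕ) → Matrix (ι k) (ι k) ℂ) (k : ℕ) (z w : ι 0) :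
    |(reBlock A r X (k + 1) - reBlock A r X k) z w| ≤ ‖avgTow A r X (k + 1) - avgTow A r X k‖ := by
  rw [Matrix.sub_apply]
  simp only [reBlock, Matrix.map_apply]
  rw [← Complex.sub_re]
  refine (Complex.abs_re_le_norm _).trans ?_
  have h := norm_entry_le_opNorm (avgTow A r X (k + 1) - avgTow A r X k) z w
  rwa [Matrix.sub_apply] at h

/-- the same for the imaginary parts. [folklore] -/
theorem abs_imBlock_succ_sub_le (A : (k : ℕ) → Matrix (ι k) (ι (k + 1)) ℂ) (r : ℝ)
    (X : (k : ℕ) → Matrix (ι k) (ι k) ℂ) (k : ℕ) (z w : ι 0) :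
    |(imBlock A r X (k + 1) - imBlock A r X k) z w| ≤ ‖avgTow A r X (k + 1) - avgTow A r X k‖ := by
  rw [Matrix.sub_apply]
  simp only [imBlock, Matrix.map_apply]
  rw [← Complex.sub_im]
  refine (Complex.abs_im_le_norm _).trans ?_
  have h := norm_entry_le_opNorm (avgTow A r X (k + 1) - avgTow A r X k) z w
  rwa [Matrix.sub_apply] at h

/-- **LEAF L05 FROM THE ROW OWNER's TOWER LAW (kernel bridge).**  Averagings with `‖A k‖² ≤ r⁻¹` and the one-step
averaged law with geometric errors `C·ρ^k` give the entrywise one-step sup rate `C·ρ^k` of the real parts of the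
unit-lattice blocks — literally the shape `NE2KingTransplant.EffectiveOperatorSupRate (reBlock A r X) C ρ` (read here
as a statement about the BLOCK tower `W_k`; it feeds `effectiveOperatorSupRate_of_block` / `_of_blockInv`).  At `U = 1`
`OneStepAveragedLaw` is a theorem of the tree (`BalabanAveragedTowerUnit.oneStepAveragedLaw_QB`, `…_Qavg`); at `U ≠ 1`
it is the row owner's typed wall. [folklore] -/
theorem reBlock_supRate (A : (k : ℕ) → Matrix (ι k) (ι (k + 1)) ℂ) {r : ℝ} (hr : 0 < r)
    (hA : ∀ k, ‖A k‖ ^ 2 ≤ r⁻¹) (X : (k : ℕ) → Matrix (ι k) (ι k) ℂ) {C ρ : ℝ}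
    (hlaw : OneStepAveragedLaw A r X (fun k => C * ρ ^ k)) :
    EffectiveOperatorSupRate (reBlock A r X) C ρ := by
  intro k z w
  exact (abs_reBlock_succ_sub_le A r X k z w).trans
    (opNorm_avgTow_succ_sub_le A hr hA X (e := fun k => C * ρ ^ k) k (hlaw k))

/-- the same for the imaginary parts. [folklore] -/
theorem imBlock_supRate (A : (k : ℕ) → Matrix (ι k) (ι (k + 1)) ℂ) {r : ℝ} (hr : 0 < r)
    (hA : ∀ k, ‖A k‖ ^ 2 ≤ r⁻¹) (X : (k : ℕ) → Matrix (ι k) (ι k) ℂ) {C ρ : ℝ}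
    (hlaw : OneStepAveragedLaw A r X (fun k => C * ρ ^ k)) :
    EffectiveOperatorSupRate (imBlock A r X) C ρ := by
  intro k z w
  exact (abs_imBlock_succ_sub_le A r X k z w).trans
    (opNorm_avgTow_succ_sub_le A hr hA X (e := fun k => C * ρ ^ k) k (hlaw k))

/-- uniform entry bound of the real parts from a uniform operator-norm bound of the images. [folklore] -/
theorem abs_reBlock_le (A : (k : ℕ) → Matrix (ι k) (ι (k + 1)) ℂ) (r : ℝ) (X : (k : ℕ) → Matrix (ι k) (ι k) ℂ)
    {CW : ℝ} (hb : ∀ k, ‖avgTow A r X k‖ ≤ CW) (k : ℕ) (z w : ι 0) : |reBlock A r X k z w| ≤ CW := by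
  simp only [reBlock, Matrix.map_apply]
  exact ((Complex.abs_re_le_norm _).trans (norm_entry_le_opNorm _ z w)).trans (hb k)

/-- **THE COMPOSITION BY NAME (King's (2.14) shape).**  The row owner's one-step averaged law (geometric errors
`θ_W·ρ^k`) + a uniform operator-norm bound `C_W` of the images + a coefficient sequence `a_k` with `|a_{k+1} − a_k| ≤
θ_a ρ^k`, `|a_k| ≤ ā` ⟹ the rate leaf (H3) of `Spine/NE2KingTransplant` for the (2.14)-shaped effective operators built
on the real parts of the blocks: `EffectiveOperatorSupRate (effOp a (reBlock A r X)) (θ_a + 2āθ_aC_W + ā²θ_W) ρ`.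
[folklore] -/
theorem effectiveOperatorSupRate_of_oneStepAveragedLaw (A : (k : ℕ) → Matrix (ι k) (ι (k + 1)) ℂ) {r : ℝ}
    (hr : 0 < r) (hA : ∀ k, ‖A k‖ ^ 2 ≤ r⁻¹) (X : (k : ℕ) → Matrix (ι k) (ι k) ℂ) (a : ℕ → ℝ)
    {θa abar θW CW ρ : ℝ} (ha : ∀ k, |a (k + 1) - a k| ≤ θa * ρ ^ k) (hab : ∀ k, |a k| ≤ abar)
    (hlaw : OneStepAveragedLaw A r X (fun k => θW * ρ ^ k)) (hb : ∀ k, ‖avgTow A r X k‖ ≤ CW) :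
    EffectiveOperatorSupRate (effOp a (reBlock A r X)) (θa + 2 * abar * θa * CW + abar ^ 2 * θW) ρ :=
  effectiveOperatorSupRate_of_block a (reBlock A r X) ha hab (reBlock_supRate A hr hA X hlaw)
    (abs_reBlock_le A r X hb)

end Summit.QuantumFields.BalabanUV.T4Continuum.NE2KingTransplantBridge

end
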